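import Literature.AnabelianGeometry.SemiGraphs.TemperedEdgeImagesOfNoUnfoldedSubjoint
import Literature.AnabelianGeometry.SemiGraphs.TemperedCompactInVerticialAtOfFixedSystems
import HarnessLib

/-!
# [SemiAnbd] Thm 3.7 (iii) AT `𝒢` from «eventually no unfolded fixed subjoint» at the canonical tower

Mochizuki, *Semi-graphs of anabelioids*, Publ. RIMS **42** (2006), §3, Theorem 3.7 (iii) p. 41 and
Corollary 3.9 p. 42 [cite: MochizukiSemiAnbd2006, Thm 3.7(iii) p.41].

PROOF-ONLY (cell abc-iut, layer L3, GAP row G-t6g3-2b, sub-row (B3-U); seat abc-iut-w5-d212; no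
definition, no named fact).  The canonical-tower corollaries of `TemperedEdgeImagesOfNoUnfoldedSubjoint.lean`:
at the canonical data `verticialLevelData_temperedPiChart h36` (abc-iut-L3-t8), the single input

  (hno∞) for every compact `C ≠ 1`: for every level `j` there is `k ≥ j` such that for all `k' ≥ k` no
  `C`-fixed subjoint of `𝒢_{∞,k'}` is unfolded by the transition to `𝒢_{∞,j}`

gives BOTH fixed-systems clauses (hfix, hadj), hence — through abc-iut-w4-d083/abc-iut-L3-t10's
`compactInVerticialAt_of_fixedSystems` / `cor39UpToTwistAt_of_fixedSystems` (p428299) —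

* `ProfiniteSemiGraph.compactInVerticialAt_of_eventually_noUnfolded : … → CompactInVerticialAt 𝒢`
  (and then Cor 3.9 up to twist for a pair `𝒢`, `ℋ` is abc-iut-w4-d080's `cor39UpToTwistAt` applied to
  the two conclusions, verbatim).

This is the POSITIVE half of the erratum picture for the ∀-countable form (F-1732): (hno∞) holds
uniformly at every FINITE `𝔾` (total estrangement per base subjoint, finitely many of them at each level —
abc-iut-w6-d066's (B3-L)) and under cofinite tower symmetry; it FAILS along the escaping ray of the
countermodel `𝒢_θ` (abc-iut-L3-d1, `ThetaRayEscape.lean`).  Nothing here asserts (hno∞) for any `𝒢`;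
nothing bears on [IUTchIII] Cor. 3.12; typed ≠ proved.
-/

namespace Literature.AnabelianGeometry.SemiGraphs

namespace ProfiniteSemiGraph

open CategoryTheory Topology

universe u

variable {𝒢 : ProfiniteSemiGraph.{u}}

/-- **Thm 3.7 (iii) at `𝒢` from «eventually no unfolded fixed subjoint» at the canonical tower**: if for
every compact `C ≠ 1` of `π₁^temp(𝒢)` and every level `j` there is a level `k ≥ j` beyond which no
`C`-fixed subjoint of `𝒢_{∞,k'}` is unfolded by `𝒢_{∞,k'} → 𝒢_{∞,j}`, then `CompactInVerticialAt 𝒢`.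
[cite: MochizukiSemiAnbd2006, Thm 3.7(iii) p.41] -/
theorem compactInVerticialAt_of_eventually_noUnfolded (h36 : 𝒢.Prop36Hypotheses)
    (hno : ∀ C : Subgroup (𝒢.temperedPiChart h36).G, IsCompact (C : Set (𝒢.temperedPiChart h36).G) →
      C ≠ ⊥ → ∀ j : (verticialLevelData_temperedPiChart (h36 := h36)).J,
        ∃ (k : (verticialLevelData_temperedPiChart (h36 := h36)).J) (h : j ≤ k),
        ∀ (k' : (verticialLevelData_temperedPiChart (h36 := h36)).J) (h' : k ≤ k'),
        ∀ (y : ((verticialLevelData_temperedPiChart (h36 := h36)).tree k').Vertex)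
          (δ₁ δ : ((verticialLevelData_temperedPiChart (h36 := h36)).tree k').Branch), δ₁ ≠ δ →
          ((verticialLevelData_temperedPiChart (h36 := h36)).tree k').abuts δ₁ = some y →
          ((verticialLevelData_temperedPiChart (h36 := h36)).tree k').abuts δ = some y →
          (∀ g ∈ C, ((verticialLevelData_temperedPiChart (h36 := h36)).act k' g).hom.vertexMap y = y ∧
            ((verticialLevelData_temperedPiChart (h36 := h36)).act k' g).hom.branchMap δ₁ = δ₁ ∧
            ((verticialLevelData_temperedPiChart (h36 := h36)).act k' g).hom.branchMap δ = δ) →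
          ((verticialLevelData_temperedPiChart (h36 := h36)).trans (h.trans h')).branchMap δ₁ =
            ((verticialLevelData_temperedPiChart (h36 := h36)).trans (h.trans h')).branchMap δ) :
    CompactInVerticialAt 𝒢 :=
  compactInVerticialAt_of_fixedSystems h36
    (fun C hC hC1 =>
      (verticialLevelData_temperedPiChart (h36 := h36)).hfix_of_eventually_noUnfolded C hC (hno C hC hC1))
    (fun C hC hC1 x x' hx hx' hfx hfx' j hne =>
      (verticialLevelData_temperedPiChart (h36 := h36)).hadj_of_eventually_noUnfolded C (hno C hC hC1)
        x x' hx hx' hfx hfx' j hne)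


/-- **Cor 3.9 up to twist from «eventually no unfolded fixed subjoint»** at the canonical towers of a pair
`𝒢`, `ℋ`: abc-iut-w4-d080's `cor39UpToTwistAt` applied to the two conclusions of
`compactInVerticialAt_of_eventually_noUnfolded` (conclusion shape verbatim that of
`cor39UpToTwistAt_of_fixedSystems`). [cite: MochizukiSemiAnbd2006, Cor 3.9 p.42] -/
theorem cor39UpToTwistAt_of_eventually_noUnfolded {ℋ : ProfiniteSemiGraph.{u}}
    (h36𝒢 : 𝒢.Prop36Hypotheses) (h36ℋ : ℋ.Prop36Hypotheses)
    (hno𝒢 : ∀ C : Subgroup (𝒢.temperedPiChart h36𝒢).G, IsCompact (C : Set (𝒢.temperedPiChart h36𝒢).G) →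
      C ≠ ⊥ → ∀ j : (verticialLevelData_temperedPiChart (h36 := h36𝒢)).J,
        ∃ (k : (verticialLevelData_temperedPiChart (h36 := h36𝒢)).J) (h : j ≤ k),
        ∀ (k' : (verticialLevelData_temperedPiChart (h36 := h36𝒢)).J) (h' : k ≤ k'),
        ∀ (y : ((verticialLevelData_temperedPiChart (h36 := h36𝒢)).tree k').Vertex)
          (δ₁ δ : ((verticialLevelData_temperedPiChart (h36 := h36𝒢)).tree k').Branch), δ₁ ≠ δ →
          ((verticialLevelData_temperedPiChart (h36 := h36𝒢)).tree k').abuts δ₁ = some y →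
          ((verticialLevelData_temperedPiChart (h36 := h36𝒢)).tree k').abuts δ = some y →
          (∀ g ∈ C, ((verticialLevelData_temperedPiChart (h36 := h36𝒢)).act k' g).hom.vertexMap y = y ∧
            ((verticialLevelData_temperedPiChart (h36 := h36𝒢)).act k' g).hom.branchMap δ₁ = δ₁ ∧
            ((verticialLevelData_temperedPiChart (h36 := h36𝒢)).act k' g).hom.branchMap δ = δ) →
          ((verticialLevelData_temperedPiChart (h36 := h36𝒢)).trans (h.trans h')).branchMap δ₁ =
            ((verticialLevelData_temperedPiChart (h36 := h36𝒢)).trans (h.trans h')).branchMap δ)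
    (hnoℋ : ∀ C : Subgroup (ℋ.temperedPiChart h36ℋ).G, IsCompact (C : Set (ℋ.temperedPiChart h36ℋ).G) →
      C ≠ ⊥ → ∀ j : (verticialLevelData_temperedPiChart (h36 := h36ℋ)).J,
        ∃ (k : (verticialLevelData_temperedPiChart (h36 := h36ℋ)).J) (h : j ≤ k),
        ∀ (k' : (verticialLevelData_temperedPiChart (h36 := h36ℋ)).J) (h' : k ≤ k'),
        ∀ (y : ((verticialLevelData_temperedPiChart (h36 := h36ℋ)).tree k').Vertex)
          (δ₁ δ : ((verticialLevelData_temperedPiChart (h36 := h36ℋ)).tree k').Branch), δ₁ ≠ δ →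
          ((verticialLevelData_temperedPiChart (h36 := h36ℋ)).tree k').abuts δ₁ = some y →
          ((verticialLevelData_temperedPiChart (h36 := h36ℋ)).tree k').abuts δ = some y →
          (∀ g ∈ C, ((verticialLevelData_temperedPiChart (h36 := h36ℋ)).act k' g).hom.vertexMap y = y ∧
            ((verticialLevelData_temperedPiChart (h36 := h36ℋ)).act k' g).hom.branchMap δ₁ = δ₁ ∧
            ((verticialLevelData_temperedPiChart (h36 := h36ℋ)).act k' g).hom.branchMap δ = δ) →
          ((verticialLevelData_temperedPiChart (h36 := h36ℋ)).trans (h.trans h')).branchMap δ₁ =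
            ((verticialLevelData_temperedPiChart (h36 := h36ℋ)).trans (h.trans h')).branchMap δ)
    (h𝒢 : Cor39Hypotheses 𝒢) (hℋ : Cor39Hypotheses ℋ) (c𝒢 : TemperedPiChart 𝒢) (cℋ : TemperedPiChart ℋ) :
    (∀ (F : Hom 𝒢 ℋ), F.IsLocallyOpen → ∀ φ : c𝒢.G →ₜ* cℋ.G,
        (∃ θ : F.ConjugatorFamily, Nonempty (F.chartPullbackWith θ c𝒢 cℋ ≅ BTemp.res φ)) →
          IsCompatiblyQuasiGeometric φ) ∧
      ∀ φ : c𝒢.G →ₜ* cℋ.G, IsCompatiblyQuasiGeometric φ →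
        ∃ F : Hom 𝒢 ℋ, F.IsLocallyOpen ∧
          (∃ θ : F.ConjugatorFamily, Nonempty (F.chartPullbackWith θ c𝒢 cℋ ≅ BTemp.res φ)) ∧
          ∀ F' : Hom 𝒢 ℋ, F'.IsLocallyOpen →
            (∃ θ' : F'.ConjugatorFamily, Nonempty (F'.chartPullbackWith θ' c𝒢 cℋ ≅ BTemp.res φ)) →
              F'.base.vertexMap = F.base.vertexMap ∧ F'.base.edgeMap = F.base.edgeMap :=
  cor39UpToTwistAt (compactInVerticialAt_of_eventually_noUnfolded h36𝒢 hno𝒢)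
    (compactInVerticialAt_of_eventually_noUnfolded h36ℋ hnoℋ) h𝒢 hℋ c𝒢 cℋ

end ProfiniteSemiGraph

end Literature.AnabelianGeometry.SemiGraphs
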